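import Mathlib
import HarnessLib
import Summits.Ventures.LatticeQCDFlow.Exactness.Phi4FlowSamplerErgodic
import Summits.Ventures.LatticeQCDFlow.Exactness.IMHErgodicEveryStart

/-!
# The φ⁴ flow sampler converges from every initial field, for every flow with positive density — no weight bound

HONEST FRAMING: exact (Metropolis-corrected) sampling algorithms for lattice gauge theory;
figures of merit are autocorrelation/cost numbers at stated couplings and volumes; no
continuum-physics claim.  (SCALAR calibration rung S0-A: not a gauge result.)

Venture `LatticeQCDFlow` (cell pub-lqcd), topic `Exactness`; FANOUT row 13 (`eng-snf`, GEN-17),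
an instance of GEN-17's `IMHErgodicEveryStart.lean` for row 2's S0-A flow sampler
(`Phi4FlowSamplerErgodic.lean`: `phi4FlowKernel J λ q̃ = indepMH (q̃ dφ) (e^{−S}/q̃)`,
`phi4GibbsMeasure J λ = Z⁻¹ e^{−S} dφ`, `integral_phi4GibbsMeasure`: its expectations are row 2's
`gibbsExpect`).  NEW WORK of the cell, not a published result; no definition is introduced; nothing is
cited as a fact.  Row 2 typed UNIFORM ergodicity under a weight bound `e^{−S} ≤ W·Z·q̃` (Mengersen–
Tweedie direction); this file types the bound-free qualitative statement the S0-A runs rely on.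

## Content

* `isMarkovKernel_phi4FlowKernel`; `phi4FlowKernel_invariant` — the Gibbs probability measure is
  invariant for EVERY positive measurable model density integrating to one (no weight bound);
  `flowModel_absolutelyContinuous_phi4GibbsMeasure` (`q̃ dφ ≪ Z⁻¹e^{−S} dφ`).
* **`phi4FlowSampler_tendsto_everyStart`** — `λ > 0`, any real `J`, model density `q̃ > 0` measurable
  with `∫ q̃ = 1`: for EVERY initial field `φ₀` and every measurable observable `f` integrable against
  the Gibbs measure, along the S0-A flow-sampler chain started at `φ₀`,
  `(1/N) Σ_{i<N} f(φ_i) → gibbsExpect J λ f = ⟨f⟩` almost surely.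

NOT CLAIMED: any rate (rates need the weight bound — `phi4FlowSampler_uniformly_ergodic`); anything
about a concrete trained flow.
-/

namespace Summit.Ventures.LatticeQCDFlow.Exactness

open MeasureTheory ProbabilityTheory Set Filter Finset
open Summit.Ventures.LatticeQCDFlow.Scoring
open scoped ENNReal Topology

variable {n : ℕ}

/-- The S0-A flow-sampler kernel is Markov (measurable model density). -/
theorem isMarkovKernel_phi4FlowKernel (J : Fin (n + 1) → Fin (n + 1) → ℝ) (lam : ℝ)
    {q : (Fin (n + 1) → ℝ) → ℝ} (hqm : Measurable q) [IsProbabilityMeasure (flowModel q)] :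
    IsMarkovKernel (phi4FlowKernel J lam q) := by
  haveI : Fact (Measurable fun φ => gibbsWeight J lam φ / q φ) :=
    ⟨(continuous_gibbsWeight J lam).measurable.div hqm⟩
  unfold phi4FlowKernel
  infer_instance

/-- **The Gibbs probability measure is invariant for the S0-A flow sampler, for every positive model
density integrating to one** (no weight bound; the kernel only sees weight ratios, so the
un-normalised code weight `e^{−S}/q̃` and the normalised `Z⁻¹e^{−S}/q̃` give the same kernel). -/
theorem phi4FlowKernel_invariant {lam : ℝ} (hlam : 0 < lam) (J : Fin (n + 1) → Fin (n + 1) → ℝ)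
    {q : (Fin (n + 1) → ℝ) → ℝ} (hq0 : ∀ φ, 0 < q φ) (hqm : Measurable q) (hqi : Integrable q)
    (hq1 : ∫ φ, q φ = 1) :
    haveI := isProbabilityMeasure_flowModel hq0 hqi hq1
    Kernel.Invariant (phi4FlowKernel J lam q) (phi4GibbsMeasure J lam) := by
  haveI := isProbabilityMeasure_flowModel hq0 hqi hq1
  have hZ := gibbsZ_pos hlam J
  have hpm : Measurable fun φ => gibbsWeight J lam φ / gibbsZ J lam :=
    (continuous_gibbsWeight J lam).measurable.div_const _
  have hp0 : ∀ φ, 0 < gibbsWeight J lam φ / gibbsZ J lam :=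
    fun φ => div_pos (gibbsWeight_pos J lam φ) hZ
  haveI : IsProbabilityMeasure (volume.withDensity fun φ => ENNReal.ofReal (q φ)) :=
    isProbabilityMeasure_flowModel hq0 hqi hq1
  have hker : phi4FlowKernel J lam q = indepMH (volume.withDensity fun φ => ENNReal.ofReal (q φ))
      fun φ => (gibbsWeight J lam φ / gibbsZ J lam) / q φ := by
    have e : (fun φ => (gibbsWeight J lam φ / gibbsZ J lam) / q φ) =
        fun φ => (gibbsZ J lam)⁻¹ * (gibbsWeight J lam φ / q φ) := by
      funext φ
      field_simp
    rw [e, indepMH_const_mul _ (inv_pos.2 hZ)]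
    rfl
  rw [hker]
  exact flowMCMC_invariant hpm hqm hp0 hq0

/-- The model law is absolutely continuous with respect to the Gibbs measure (both have positive
densities against Lebesgue measure). -/
theorem flowModel_absolutelyContinuous_phi4GibbsMeasure {lam : ℝ} (hlam : 0 < lam)
    (J : Fin (n + 1) → Fin (n + 1) → ℝ) (q : (Fin (n + 1) → ℝ) → ℝ) :
    flowModel q ≪ phi4GibbsMeasure J lam :=
  withDensity_ofReal_absolutelyContinuous ((continuous_gibbsWeight J lam).measurable.div_const _)
    (fun φ => div_pos (gibbsWeight_pos J lam φ) (gibbsZ_pos hlam J)) q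

/-- **THE φ⁴ FLOW SAMPLER CONVERGES FROM EVERY INITIAL FIELD.**  `λ > 0`, any real `J`; model
density `q̃ > 0` measurable with `∫ q̃ = 1` (ANY such flow, no weight bound); for EVERY initial field
`φ₀` and every measurable `f` integrable against the Gibbs measure: along the S0-A flow-sampler
chain started at `φ₀`, `(1/N) Σ_{i<N} f(φ_i) → ⟨f⟩ = gibbsExpect J λ f` almost surely. -/
theorem phi4FlowSampler_tendsto_everyStart {lam : ℝ} (hlam : 0 < lam)
    (J : Fin (n + 1) → Fin (n + 1) → ℝ) {q : (Fin (n + 1) → ℝ) → ℝ} (hq0 : ∀ φ, 0 < q φ)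
    (hqm : Measurable q) (hqi : Integrable q) (hq1 : ∫ φ, q φ = 1)
    {f : (Fin (n + 1) → ℝ) → ℝ} (hfm : Measurable f) (hf : Integrable f (phi4GibbsMeasure J lam))
    (φ₀ : Fin (n + 1) → ℝ) :
    haveI := isProbabilityMeasure_flowModel hq0 hqi hq1
    haveI := isMarkovKernel_phi4FlowKernel J lam hqm
    ∀ᵐ x ∂(Kernel.trajMeasure (X := fun _ : ℕ => Fin (n + 1) → ℝ) (Measure.dirac φ₀)
        (fun m : ℕ => (phi4FlowKernel J lam q).comap
          (fun h : (j : ↥(Finset.Iic m)) → (Fin (n + 1) → ℝ) => h ⟨m, Finset.mem_Iic.2 le_rfl⟩)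
          (measurable_pi_apply _))),
      Tendsto (fun N : ℕ => (∑ i ∈ range N, f (x i)) / N) atTop (𝓝 (gibbsExpect J lam f)) := by
  haveI := isProbabilityMeasure_flowModel hq0 hqi hq1
  haveI := isProbabilityMeasure_phi4GibbsMeasure hlam J
  have key := tendsto_sum_div_ae_indepMH_everyStart (q := flowModel q)
    (w := fun φ => gibbsWeight J lam φ / q φ)
    ((continuous_gibbsWeight J lam).measurable.div hqm)
    (fun φ => div_pos (gibbsWeight_pos J lam φ) (hq0 φ))
    (phi4FlowKernel_invariant hlam J hq0 hqm hqi hq1)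
    (flowModel_absolutelyContinuous_phi4GibbsMeasure hlam J q) hfm hf φ₀
  rw [integral_phi4GibbsMeasure] at key
  exact key

end Summit.Ventures.LatticeQCDFlow.Exactness
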